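import Mathlib
import HarnessLib
import Literature.Analysis.Calculus.IteratedDifferenceMixedBound
import Summits.HubbardSuperconductivity.HubbardSuperconductivity.Theorems.KLProgrammePerturbedFermiCurveTower
import Summits.HubbardSuperconductivity.HubbardSuperconductivity.Theorems.KLProgrammeH10TwoPointLimitFrameFermiPoint
import Summits.HubbardSuperconductivity.HubbardSuperconductivity.Theorems.KLProgrammeKLRegimeEngineFrameLevelCount

/-!
# Route `KLProgramme` — crux C4a (inductive tangential bound), sub-lemma (L1): TANGENTIAL SOFTNESS at the external vertex

Cell `gate-hubbard-kl`, lane hubbard-kl-c4a-1 (C4a INDUCTIVE TANGENTIAL BOUND, plan g15 (R24); memo HOME/hubbard-kl-c4a-1/C4A-PLAN.md §2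
mechanism (M2), §6 (L1)).  Helper for the ENGINE item stmt-HubbardSuperconductivity-20236, sixth stub (`stub_twoLeg_curvature`: angular
jets `k = 2 … 4` of the scale-`n` local-part increment `δ_n` read on the frame's Fermi curve).

THE MECHANISM.  Let `F` be a level function (`e_K = ε − μ − K` read on `Momentum`) and `γ` a parametrisation of its zero set (the frame's
Fermi curve `θ ↦ k_F^K(θ)`), so `F ∘ γ ≡ c` (`c = 0`).  In the one-slice tadpole that drives the two-leg increment, the slice line carries
`q = k_F(θ) − P` (Cooper configuration, by inversion symmetry; forward/exchange configurations directly), and a TANGENTIAL derivative of the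
reading — a `θ`-derivative — acts on the propagator only through `E(P, θ) := F(γ θ − P)`.  Since `E(0, ·) ≡ c`, EVERY `θ`-derivative of
`E(P, ·)` vanishes at `P = 0`, hence is `O(‖P‖)`:

* `abs_sub_le_of_level` / `abs_iteratedDeriv_level_shift_le` (§1): with `‖DᵏF‖ ≤ A k` (`1 ≤ k ≤ 5`) everywhere and `‖γ⁽ⁱ⁾(θ)‖ ≤ D i`
  (`1 ≤ i ≤ 4`): `|F(γ θ − P) − c| ≤ A 1·‖P‖` and
  `|∂_θ¹ E| ≤ ‖P‖·A 2·D 1`, `|∂_θ² E| ≤ ‖P‖·(A 3·D 1² + A 2·D 2)`, `|∂_θ³ E| ≤ ‖P‖·(A 4·D 1³ + 3·A 3·D 1·D 2 + A 2·D 3)`,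
  `|∂_θ⁴ E| ≤ ‖P‖·(A 5·D 1⁴ + 6·A 4·D 1²·D 2 + 3·A 3·D 2² + 4·A 3·D 1·D 3 + A 2·D 4)`
  — the Bell-polynomial chain bounds of `…PerturbedFermiCurveCompChainStruct` applied to the DIFFERENCE `x ↦ F(x − P) − F(x)` (whose
  `k`-jets are `≤ A (k+1)·‖P‖` by the mean value inequality, `Literature.Analysis.Calculus.norm_iteratedFDeriv_fwdDiff_le`).
* `abs_iteratedDeriv_profile_level_shift_le` (§2): for a `C⁴` profile `f : ℝ → ℝ` (a slice propagator as a function of the band energy at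
  fixed frequency) with `|f⁽ᵐ⁾(E(P,θ))| ≤ N m`, the reading `θ ↦ f(F(γ θ − P))` has
  `|∂_θ²| ≤ N 2·(‖P‖·S₁)² + N 1·(‖P‖·S₂)` etc. (orders `1 … 4`), `S_j` the softness constants of §1 — versus `N 2·(A 1·D 1)² + …` for a
  direction in which `F ∘ γ` is not constant.  With `N m ≍ Λ^{−1−m}` on a slice of scale `Λ` this is the `|G|³‖P‖² + |G|²‖P‖` law of the
  memo (§2), the source of the `2^{−n}` decay of the generic-angle tangential Hessian increment and of the near/far crossover at the
  sector length `ρ = Λ^{1/2}`.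

* `abs_iteratedDeriv_frameLevel_shift_le` (§3): the instantiation at the frame band `F = frameLevel μ K` and the frame's curve
  `γ = toLp ∘ klFermiPoint μ K` in the cell's regime binders (`FrameOK R U (nScales β) μ K`, `c ≤ klCurveC3 R`, `U ≤ klCurveU0 R`,
  `μ ∈ klWindowC`; curve sizes `klCurveD1 … klCurveD4 A₃ A₄` of …PerturbedFermiCurveTower, `frameLevel_klFermiPoint`), the global jets
  `‖Dᵏe_K‖ ≤ A k` of the frame band kept as the consumer's hypothesis.

§1–§2 are carrier-free (any real normed space `V`) pure calculus; nothing is asserted about the Hubbard model.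
References: Feldman–Salmhofer–Trubowitz, CPAM 51 (1998) 1133 (FST II) Thm 3.5 (the change of variables that «prevents the derivative
from degrading the scale behaviour»), CPAM 52 (1999) 273 (FST III) §3.6 [arXiv:cond-mat/9705272 p.147]; BGM 2006 §2.4
[cite: BenfattoGiulianiMastropietro2006].
-/

noncomputable section

namespace Summit.HubbardSuperconductivity.HubbardSuperconductivity.Theorems.C4a

set_option linter.dupNamespace false -- summit = problem name (single-conjunct summit), D-0017

open Real Set
open Literature.Analysis.Calculus
open Summit.HubbardSuperconductivity.HubbardSuperconductivity.Theorems.PerturbedFermiCurve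

variable {V : Type*} [NormedAddCommGroup V] [NormedSpace ℝ V]

/-! ## §1 Softness of the shifted level function `θ ↦ F(γ θ − P)` -/

section Level

variable {F : V → ℝ} {γ : ℝ → V} {c : ℝ} {P : V}

omit [NormedSpace ℝ V] in
/-- The shifted reading is the constant level plus the forward difference `Δ_{−P}F` read along the curve:
`F(γ θ − P) = c + (Δ_{−P} F)(γ θ)` when `F ∘ γ ≡ c`. -/
theorem level_shift_eq_const_add_fwdDiff_comp (hzero : ∀ θ, F (γ θ) = c) :
    (fun θ => F (γ θ - P)) = fun θ => c + (fwdDiff (-P) F ∘ γ) θ := by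
  funext θ
  simp only [Function.comp_apply, fwdDiff, hzero θ, sub_eq_add_neg]
  ring

/-- **Order zero**: `|F(γ θ − P) − c| ≤ A₁·‖P‖` when `F ∘ γ ≡ c` and `‖DF‖ ≤ A₁` everywhere (`F` Lipschitz). -/
theorem abs_level_shift_sub_le (hF : ContDiff ℝ 1 F) (hzero : ∀ θ, F (γ θ) = c) {A₁ : ℝ}
    (hA₁ : ∀ y, ‖iteratedFDeriv ℝ 1 F y‖ ≤ A₁) (θ : ℝ) : |F (γ θ - P) - c| ≤ A₁ * ‖P‖ := by
  have h := norm_fwdDiff_iter_le (-P) 1 (f := F) (K := A₁) (by exact_mod_cast hF) hA₁ (γ θ)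
  have h' : ‖fwdDiff (-P) F (γ θ)‖ ≤ A₁ * ‖P‖ := by simpa [norm_neg] using h
  have heq : F (γ θ - P) - c = fwdDiff (-P) F (γ θ) := by
    simp only [fwdDiff, hzero θ, sub_eq_add_neg]
  rw [heq, ← Real.norm_eq_abs]
  exact h'

/-- The jets of the difference `Δ_{−P}F` along the curve: `‖Dᵏ(Δ_{−P}F)(γ θ)‖ ≤ A (k+1)·‖P‖` for `1 ≤ k ≤ 4`
(mean value inequality on `DᵏF`, `F ∈ C⁵` with `‖DᵏF‖ ≤ A k`). -/
theorem norm_iteratedFDeriv_fwdDiff_comp_le (hF : ContDiff ℝ 5 F) {A : ℕ → ℝ}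
    (hA : ∀ k, 1 ≤ k → k ≤ 5 → ∀ y, ‖iteratedFDeriv ℝ k F y‖ ≤ A k) (θ : ℝ) :
    ∀ k, 1 ≤ k → k ≤ 4 → ‖iteratedFDeriv ℝ k (fwdDiff (-P) F) (γ θ)‖ ≤ A (k + 1) * ‖P‖ := by
  intro k hk1 hk4
  have hle : ((k + 1 : ℕ) : WithTop ℕ∞) ≤ 5 := by exact_mod_cast (by omega : k + 1 ≤ 5)
  have h := norm_iteratedFDeriv_fwdDiff_le (i := k) (hF.of_le hle) (hA (k + 1) (by omega) (by omega)) (-P) (γ θ)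
  simpa [norm_neg] using h

omit [NormedSpace ℝ V] in
/-- For `n ≥ 1` the `θ`-derivatives of the shifted reading are those of `Δ_{−P}F ∘ γ`. -/
theorem iteratedDeriv_level_shift_eq (hzero : ∀ θ, F (γ θ) = c) {n : ℕ} (hn : 1 ≤ n) (θ : ℝ) :
    iteratedDeriv n (fun θ => F (γ θ - P)) θ = iteratedDeriv n (fwdDiff (-P) F ∘ γ) θ := by
  rw [level_shift_eq_const_add_fwdDiff_comp hzero, iteratedDeriv_const_add (by omega) c]

/-- **Tangential softness of the shifted level function (orders 1 … 4).**  `F ∘ γ ≡ c`, `‖DᵏF‖ ≤ A k` (`1 ≤ k ≤ 5`) everywhere,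
`‖γ⁽ⁱ⁾(θ)‖ ≤ D i` (`1 ≤ i ≤ 4`).  Then every `θ`-derivative of `θ ↦ F(γ θ − P)` is `O(‖P‖)`, with the Bell-polynomial constants of
`abs_iteratedDeriv_comp_le_bell` in which `A (k+1)·‖P‖` replaces `‖DᵏF(γ θ)‖`:
`|∂¹| ≤ ‖P‖·A 2·D 1`, `|∂²| ≤ ‖P‖·(A 3·D 1² + A 2·D 2)`, `|∂³| ≤ ‖P‖·(A 4·D 1³ + 3A 3·D 1·D 2 + A 2·D 3)`,
`|∂⁴| ≤ ‖P‖·(A 5·D 1⁴ + 6A 4·D 1²D 2 + 3A 3·D 2² + 4A 3·D 1·D 3 + A 2·D 4)`. -/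
theorem abs_iteratedDeriv_level_shift_le (hF : ContDiff ℝ 5 F) (hγ : ContDiff ℝ 4 γ) (hzero : ∀ θ, F (γ θ) = c)
    {A D : ℕ → ℝ} (hA : ∀ k, 1 ≤ k → k ≤ 5 → ∀ y, ‖iteratedFDeriv ℝ k F y‖ ≤ A k) {θ : ℝ}
    (hD : ∀ i, 1 ≤ i → i ≤ 4 → ‖iteratedDeriv i γ θ‖ ≤ D i) :
    |iteratedDeriv 1 (fun θ => F (γ θ - P)) θ| ≤ ‖P‖ * (A 2 * D 1) ∧
      |iteratedDeriv 2 (fun θ => F (γ θ - P)) θ| ≤ ‖P‖ * (A 3 * D 1 ^ 2 + A 2 * D 2) ∧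
      |iteratedDeriv 3 (fun θ => F (γ θ - P)) θ| ≤ ‖P‖ * (A 4 * D 1 ^ 3 + 3 * A 3 * D 1 * D 2 + A 2 * D 3) ∧
      |iteratedDeriv 4 (fun θ => F (γ θ - P)) θ| ≤
        ‖P‖ * (A 5 * D 1 ^ 4 + 6 * A 4 * D 1 ^ 2 * D 2 + 3 * A 3 * D 2 ^ 2 + 4 * A 3 * D 1 * D 3 + A 2 * D 4) := by
  have hH : ContDiff ℝ 4 (fwdDiff (-P) F) := contDiff_fwdDiff (hF.of_le (by norm_num)) (-P)
  have hM := norm_iteratedFDeriv_fwdDiff_comp_le (γ := γ) (P := P) hF hA θ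
  obtain ⟨b1, b2, b3, b4⟩ :=
    abs_iteratedDeriv_comp_le_bell (M := fun k => A (k + 1) * ‖P‖) (D := D) hH hγ (θ := θ) hM hD
  rw [iteratedDeriv_level_shift_eq hzero le_rfl, iteratedDeriv_level_shift_eq hzero (by norm_num),
    iteratedDeriv_level_shift_eq hzero (by norm_num), iteratedDeriv_level_shift_eq hzero (by norm_num)]
  refine ⟨b1.trans (le_of_eq (by ring)), b2.trans (le_of_eq (by ring)), b3.trans (le_of_eq (by ring)),
    b4.trans (le_of_eq (by ring))⟩

end Level

/-! ## §2 A profile read through the shifted level function: `θ ↦ f(F(γ θ − P))` -/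

section Profile

variable {F : V → ℝ} {γ : ℝ → V} {c : ℝ} {P : V} {f : ℝ → ℝ}

omit [NormedSpace ℝ V] in
/-- **Bell bounds for a profile of a SOFT argument.**  If the argument `E(θ) = F(γ θ − P)` has `‖E⁽ⁱ⁾(θ)‖ ≤ ‖P‖·S i` (`1 ≤ i ≤ 4`, §1)
and the profile has `|f⁽ᵐ⁾(E θ)| ≤ N m` (`1 ≤ m ≤ 4`), then
`|∂¹(f∘E)| ≤ N 1·‖P‖S 1`, `|∂²(f∘E)| ≤ N 2·(‖P‖S 1)² + N 1·‖P‖S 2`,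
`|∂³(f∘E)| ≤ N 3·(‖P‖S 1)³ + 3N 2·(‖P‖S 1)(‖P‖S 2) + N 1·‖P‖S 3`,
`|∂⁴(f∘E)| ≤ N 4·(‖P‖S 1)⁴ + 6N 3·(‖P‖S 1)²(‖P‖S 2) + 3N 2·(‖P‖S 2)² + 4N 2·(‖P‖S 1)(‖P‖S 3) + N 1·‖P‖S 4`:
every term carries at least one factor `‖P‖`, and the term with the `m`-th profile derivative carries `‖P‖ᵐ` — for a slice
propagator (`N m ≍ Λ^{−1−m}`) the `|G|^{1+m}‖P‖ᵐ` law of C4A-PLAN §2 (vs `|G|^{1+m}` for a hard direction). -/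
theorem abs_iteratedDeriv_profile_comp_le_of_soft (hf : ContDiff ℝ 4 f) (hE : ContDiff ℝ 4 fun θ => F (γ θ - P))
    {N S : ℕ → ℝ} {θ : ℝ} (hN : ∀ m, 1 ≤ m → m ≤ 4 → |iteratedDeriv m f (F (γ θ - P))| ≤ N m)
    (hS : ∀ i, 1 ≤ i → i ≤ 4 → ‖iteratedDeriv i (fun θ => F (γ θ - P)) θ‖ ≤ ‖P‖ * S i) :
    |iteratedDeriv 1 (fun θ => f (F (γ θ - P))) θ| ≤ N 1 * (‖P‖ * S 1) ∧
      |iteratedDeriv 2 (fun θ => f (F (γ θ - P))) θ| ≤ N 2 * (‖P‖ * S 1) ^ 2 + N 1 * (‖P‖ * S 2) ∧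
      |iteratedDeriv 3 (fun θ => f (F (γ θ - P))) θ| ≤
        N 3 * (‖P‖ * S 1) ^ 3 + 3 * N 2 * (‖P‖ * S 1) * (‖P‖ * S 2) + N 1 * (‖P‖ * S 3) ∧
      |iteratedDeriv 4 (fun θ => f (F (γ θ - P))) θ| ≤
        N 4 * (‖P‖ * S 1) ^ 4 + 6 * N 3 * (‖P‖ * S 1) ^ 2 * (‖P‖ * S 2) + 3 * N 2 * (‖P‖ * S 2) ^ 2 +
          4 * N 2 * (‖P‖ * S 1) * (‖P‖ * S 3) + N 1 * (‖P‖ * S 4) := by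
  have hM : ∀ k, 1 ≤ k → k ≤ 4 → ‖iteratedFDeriv ℝ k f ((fun θ => F (γ θ - P)) θ)‖ ≤ N k := by
    intro k hk1 hk4
    rw [norm_iteratedFDeriv_eq_norm_iteratedDeriv, Real.norm_eq_abs]
    exact hN k hk1 hk4
  have h := abs_iteratedDeriv_comp_le_bell (F := f) (γ := fun θ => F (γ θ - P)) (M := N) (D := fun i => ‖P‖ * S i)
    hf hE (θ := θ) hM hS
  exact h

/-- **The tangential jets of a profile read on a slice line at the Fermi curve** (§1 + the Bell bounds): `F ∈ C⁵` with
`‖DᵏF‖ ≤ A k` (`1 ≤ k ≤ 5`), `F ∘ γ ≡ c`, `γ ∈ C⁴` with `‖γ⁽ⁱ⁾(θ)‖ ≤ D i`, `f ∈ C⁴` with `|f⁽ᵐ⁾(F(γ θ − P))| ≤ N m`.  Orders 1, 2: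
`|∂_θ f(F(γ θ − P))| ≤ N 1·‖P‖·A 2·D 1` and
`|∂_θ² f(F(γ θ − P))| ≤ N 2·(‖P‖·A 2·D 1)² + N 1·‖P‖·(A 3·D 1² + A 2·D 2)` — BOTH terms vanish at `P = 0`; with `N m ≍ Λ^{−1−m}`:
`≲ Λ⁻³‖P‖² + Λ⁻²‖P‖` (C4A-PLAN §2 (M2)). -/
theorem abs_iteratedDeriv_two_profile_level_shift_le (hF : ContDiff ℝ 5 F) (hγ : ContDiff ℝ 4 γ) (hzero : ∀ θ, F (γ θ) = c)
    (hf : ContDiff ℝ 4 f) {A D N : ℕ → ℝ} (hA : ∀ k, 1 ≤ k → k ≤ 5 → ∀ y, ‖iteratedFDeriv ℝ k F y‖ ≤ A k) {θ : ℝ}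
    (hD : ∀ i, 1 ≤ i → i ≤ 4 → ‖iteratedDeriv i γ θ‖ ≤ D i)
    (hN : ∀ m, 1 ≤ m → m ≤ 4 → |iteratedDeriv m f (F (γ θ - P))| ≤ N m) :
    |iteratedDeriv 1 (fun θ => f (F (γ θ - P))) θ| ≤ N 1 * (‖P‖ * (A 2 * D 1)) ∧
      |iteratedDeriv 2 (fun θ => f (F (γ θ - P))) θ| ≤
        N 2 * (‖P‖ * (A 2 * D 1)) ^ 2 + N 1 * (‖P‖ * (A 3 * D 1 ^ 2 + A 2 * D 2)) := by
  have hE : ContDiff ℝ 4 fun θ => F (γ θ - P) := (hF.of_le (by norm_num)).comp (hγ.sub contDiff_const)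
  obtain ⟨s1, s2, s3, s4⟩ := abs_iteratedDeriv_level_shift_le (P := P) hF hγ hzero hA (θ := θ) hD
  set S : ℕ → ℝ := fun i => if i = 1 then A 2 * D 1 else if i = 2 then A 3 * D 1 ^ 2 + A 2 * D 2
    else if i = 3 then A 4 * D 1 ^ 3 + 3 * A 3 * D 1 * D 2 + A 2 * D 3
    else A 5 * D 1 ^ 4 + 6 * A 4 * D 1 ^ 2 * D 2 + 3 * A 3 * D 2 ^ 2 + 4 * A 3 * D 1 * D 3 + A 2 * D 4 with hSdef
  have hS : ∀ i, 1 ≤ i → i ≤ 4 → ‖iteratedDeriv i (fun θ => F (γ θ - P)) θ‖ ≤ ‖P‖ * S i := by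
    intro i hi1 hi4
    rw [Real.norm_eq_abs]
    interval_cases i
    · simpa [hSdef] using s1
    · simpa [hSdef] using s2
    · simpa [hSdef] using s3
    · simpa [hSdef] using s4
  obtain ⟨b1, b2, -, -⟩ := abs_iteratedDeriv_profile_comp_le_of_soft (f := f) hf hE hN hS
  exact ⟨by simpa [hSdef] using b1, by simpa [hSdef] using b2⟩

end Profile

/-! ## §3 Instantiation: the frame band read on a slice line at the frame's own Fermi curve (regime binders) -/

section Frame

open Literature.MathematicalPhysics.QuantumLattice Literature.MathematicalPhysics.QuantumLattice.BandSectorCounting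
open Literature.Probability.LatticeModels Literature.MathematicalPhysics.QuantumLattice.FermiRG
open Summit.HubbardSuperconductivity.HubbardSuperconductivity.Theorems.DispersionFlow
open Summit.HubbardSuperconductivity.HubbardSuperconductivity.Theorems.KLRegimeSplit

/-- **Tangential softness at the frame's Fermi curve, in the regime.**  For an admissible frame `K` (`FrameOK R U (nScales β) μ K`,
`0 < c ≤ klCurveC3 R`, `0 < U ≤ klCurveU0 R`, `klBetaMin ≤ β ≤ e^{c/U²}`, `μ ∈ klWindowC`) with order-3/4 sizes `A₃, A₄` of `frameShift K`
and global jets `‖Dᵏ(frameLevel μ K)‖ ≤ A k` (`1 ≤ k ≤ 5`), the shifted band `θ ↦ e_K(k_F^K(θ) − P)` — the energy of the slice line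
`q = k_F(θ) − P` in the Cooper configuration of the one-slice tadpole — has
`|∂_θ¹| ≤ ‖P‖·A 2·D₁`, `|∂_θ²| ≤ ‖P‖·(A 3·D₁² + A 2·D₂)`, `|∂_θ³| ≤ ‖P‖·(A 4·D₁³ + 3A 3·D₁D₂ + A 2·D₃)`,
`|∂_θ⁴| ≤ ‖P‖·(A 5·D₁⁴ + 6A 4·D₁²D₂ + 3A 3·D₂² + 4A 3·D₁D₃ + A 2·D₄)` with `D_i = klCurveD_i` — all `O(‖P‖)`, versus `O(1)` for a
direction transversal to the curve. -/
theorem abs_iteratedDeriv_frameLevel_shift_le {R : RenConsts} (hR : ∀ j, 0 ≤ R.Gfr j) {c : ℝ} (hc : 0 < c)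
    (hcle : c ≤ klCurveC3 R) {U : ℝ} (hU : 0 < U) (hUle : U ≤ klCurveU0 R) {β : ℝ} (hβmin : klBetaMin ≤ β)
    (hβc : β ≤ Real.exp (c / U ^ 2)) {μ : ℝ} (hμ : μ ∈ klWindowC) {K : TrigPolyC4v} (hK : FrameOK R U (nScales β) μ K)
    {A₃ A₄ : ℝ} (hA₃ : ∀ p : Momentum, ‖iteratedFDeriv ℝ 3 (frameShift K) p‖ ≤ A₃)
    (hA₄ : ∀ p : Momentum, ‖iteratedFDeriv ℝ 4 (frameShift K) p‖ ≤ A₄)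
    {A : ℕ → ℝ} (hAF : ∀ k, 1 ≤ k → k ≤ 5 → ∀ y : Momentum, ‖iteratedFDeriv ℝ k (frameLevel μ K) y‖ ≤ A k)
    (P : Momentum) (θ : ℝ) :
    |iteratedDeriv 1 (fun θ : ℝ => frameLevel μ K (WithLp.toLp 2 (klFermiPoint μ K θ) - P)) θ| ≤ ‖P‖ * (A 2 * klCurveD1) ∧
      |iteratedDeriv 2 (fun θ : ℝ => frameLevel μ K (WithLp.toLp 2 (klFermiPoint μ K θ) - P)) θ| ≤
        ‖P‖ * (A 3 * klCurveD1 ^ 2 + A 2 * klCurveD2) ∧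
      |iteratedDeriv 3 (fun θ : ℝ => frameLevel μ K (WithLp.toLp 2 (klFermiPoint μ K θ) - P)) θ| ≤
        ‖P‖ * (A 4 * klCurveD1 ^ 3 + 3 * A 3 * klCurveD1 * klCurveD2 + A 2 * klCurveD3 A₃) ∧
      |iteratedDeriv 4 (fun θ : ℝ => frameLevel μ K (WithLp.toLp 2 (klFermiPoint μ K θ) - P)) θ| ≤
        ‖P‖ * (A 5 * klCurveD1 ^ 4 + 6 * A 4 * klCurveD1 ^ 2 * klCurveD2 + 3 * A 3 * klCurveD2 ^ 2 +
          4 * A 3 * klCurveD1 * klCurveD3 A₃ + A 2 * klCurveD4 A₃ A₄) := by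
  have ha : (-4 : ℝ) < -1.1 := by norm_num
  have hab : (-1.1 : ℝ) ≤ -0.1 := by norm_num
  have hb : (-0.1 : ℝ) < 0 := by norm_num
  set B := bandBounds ha hab hb with hBdef
  obtain ⟨hAf, -, -, -, ⟨hlo, hhi⟩, -, -⟩ := frame_sizes_of_frameOK_explicit hR hc hcle hU hUle hβmin hβc hμ hK
  obtain ⟨hγ, g1, g2, g3, g4⟩ := fermiPointLp_sizes_explicit hR hc hcle hU hUle hβmin hβc hμ hK hA₃ hA₄ θ
  have hzero : ∀ θ : ℝ, frameLevel μ K ((fun θ : ℝ => (WithLp.toLp 2 (klFermiPoint μ K θ) : Momentum)) θ) = 0 :=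
    fun θ => frameLevel_klFermiPoint B hAf hlo hhi θ
  set D : ℕ → ℝ := fun i => if i = 1 then klCurveD1 else if i = 2 then klCurveD2 else if i = 3 then klCurveD3 A₃
    else klCurveD4 A₃ A₄ with hDdef
  have hD : ∀ i, 1 ≤ i → i ≤ 4 →
      ‖iteratedDeriv i (fun θ : ℝ => (WithLp.toLp 2 (klFermiPoint μ K θ) : Momentum)) θ‖ ≤ D i := by
    intro i hi1 hi4
    rw [← norm_iteratedFDeriv_eq_norm_iteratedDeriv]
    interval_cases i
    · simpa [hDdef] using g1
    · simpa [hDdef] using g2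
    · simpa [hDdef] using g3
    · simpa [hDdef] using g4
  obtain ⟨b1, b2, b3, b4⟩ := abs_iteratedDeriv_level_shift_le (P := P) (EngineV8.contDiff_frameLevel μ K) hγ hzero hAF (θ := θ) hD
  exact ⟨by simpa [hDdef] using b1, by simpa [hDdef] using b2, by simpa [hDdef] using b3, by simpa [hDdef] using b4⟩

end Frame


/-! ## §4 Soft jets near a RIGID configuration (appended: the multi-point form of §1, C4A-PLAN §10)

The principle behind §1, for any number of co-moving points: if a smooth function `G` of (configuration `x`, flow time `t`) vanishes identically in
`t` at the rigid configuration `x₀` (every line energy of a `G = 0` singular configuration is constant under the co-moving flow), then the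
`t`-jets of `G(x, ·)` are `O(‖x − x₀‖)`: the mean value inequality for `DʲG` in the configuration variable, read along the time axis
`t ↦ (x, t) = inr t + (x, 0)` (`ContinuousLinearMap.iteratedFDeriv_comp_right`). -/

section Rigid

open Literature.Analysis.Calculus

variable {X : Type*} [NormedAddCommGroup X] [NormedSpace ℝ X]

/-- The `t`-jets of `G(x, ·)` are the iterated Fréchet derivatives of `G` along the time axis:
`‖∂ₜʲ G(x, t)‖ = ‖DʲG(x, t) ∘ (inr, …, inr)‖`. -/
theorem norm_iteratedDeriv_slice_eq {G : X × ℝ → ℝ} {j : ℕ} (hG : ContDiff ℝ j G) (x : X) (t : ℝ) :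
    ‖iteratedDeriv j (fun t : ℝ => G (x, t)) t‖ =
      ‖(iteratedFDeriv ℝ j G (x, t)).compContinuousLinearMap fun _ => ContinuousLinearMap.inr ℝ X ℝ‖ := by
  rw [← norm_iteratedFDeriv_eq_norm_iteratedDeriv]
  have hfun : (fun t : ℝ => G (x, t)) =
      (fun y : X × ℝ => G (y + ((x, (0 : ℝ)) : X × ℝ))) ∘ (ContinuousLinearMap.inr ℝ X ℝ) := by
    funext t; simp
  have h2 : ContDiff ℝ j (fun y : X × ℝ => G (y + ((x, (0 : ℝ)) : X × ℝ))) := hG.comp (contDiff_id.add contDiff_const)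
  rw [hfun, (ContinuousLinearMap.inr ℝ X ℝ).iteratedFDeriv_comp_right h2 t (i := j) (by exact_mod_cast le_rfl),
    iteratedFDeriv_comp_add_right]
  have hpt : (ContinuousLinearMap.inr ℝ X ℝ) t + ((x, (0 : ℝ)) : X × ℝ) = (x, t) := by simp
  rw [hpt]

/-- **Soft jets near a rigid configuration.**  `G : X × ℝ → ℝ` of class `C^{j+1}` with `‖D^{j+1}G‖ ≤ K` everywhere and `G(x₀, t) = 0` for all `t`
(the configuration `x₀` is RIGID under the flow).  Then for every configuration `x` and time `t`:
`|∂ₜʲ G(x, t)| ≤ K·‖x − x₀‖` — every `t`-jet is `O(dist to the rigid configuration)`. -/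
theorem abs_iteratedDeriv_le_of_rigid {G : X × ℝ → ℝ} {j : ℕ} (hG : ContDiff ℝ (↑(j + 1 : ℕ)) G) {K : ℝ}
    (hK : ∀ p, ‖iteratedFDeriv ℝ (j + 1) G p‖ ≤ K) {x₀ : X} (h0 : ∀ t, G (x₀, t) = 0) (x : X) (t : ℝ) :
    |iteratedDeriv j (fun t : ℝ => G (x, t)) t| ≤ K * ‖x - x₀‖ := by
  have hle : ((j : ℕ) : WithTop ℕ∞) ≤ ((j + 1 : ℕ) : WithTop ℕ∞) := by exact_mod_cast Nat.le_succ j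
  have hGj : ContDiff ℝ j G := hG.of_le hle
  set L : ℝ →L[ℝ] X × ℝ := ContinuousLinearMap.inr ℝ X ℝ with hL
  -- the jets at x and at x₀ along the time axis
  have hx := norm_iteratedDeriv_slice_eq hGj x t
  have hx0 := norm_iteratedDeriv_slice_eq hGj x₀ t
  have hzero : iteratedDeriv j (fun t : ℝ => G (x₀, t)) t = 0 := by
    have : (fun t : ℝ => G (x₀, t)) = fun _ => (0 : ℝ) := funext h0
    rw [this, iteratedDeriv_const]
    simp
  have hnorm0 : ‖(iteratedFDeriv ℝ j G (x₀, t)).compContinuousLinearMap fun _ => L‖ = 0 := by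
    rw [hL, ← hx0, hzero, norm_zero]
  -- the difference of the two multilinear maps, composed with the (norm ≤ 1) time axis
  have hdiff : ‖(iteratedFDeriv ℝ j G (x, t)).compContinuousLinearMap (fun _ => L)‖ ≤
      ‖iteratedFDeriv ℝ j G (x, t) - iteratedFDeriv ℝ j G (x₀, t)‖ := by
    have hsplit : (iteratedFDeriv ℝ j G (x, t)).compContinuousLinearMap (fun _ => L) =
        (iteratedFDeriv ℝ j G (x, t) - iteratedFDeriv ℝ j G (x₀, t)).compContinuousLinearMap (fun _ => L) +
          (iteratedFDeriv ℝ j G (x₀, t)).compContinuousLinearMap (fun _ => L) := by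
      rw [← ContinuousMultilinearMap.compContinuousLinearMapL_apply, ← ContinuousMultilinearMap.compContinuousLinearMapL_apply,
        ← ContinuousMultilinearMap.compContinuousLinearMapL_apply, ← map_add, sub_add_cancel]
    rw [hsplit]
    refine (norm_add_le _ _).trans ?_
    rw [hnorm0, add_zero]
    refine (ContinuousMultilinearMap.norm_compContinuousLinearMap_le _ _).trans ?_
    have hL1 : ∏ _i : Fin j, ‖L‖ ≤ 1 := by
      rw [Finset.prod_const, Finset.card_univ, Fintype.card_fin]
      exact pow_le_one₀ (norm_nonneg _) (by rw [hL]; exact ContinuousLinearMap.norm_inr_le_one ℝ X ℝ)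
    exact mul_le_of_le_one_right (norm_nonneg _) hL1
  -- the mean value inequality for DʲG in the configuration variable
  have hmvt : ‖iteratedFDeriv ℝ j G (x, t) - iteratedFDeriv ℝ j G (x₀, t)‖ ≤ K * ‖x - x₀‖ := by
    have h := norm_iteratedFDeriv_sub_le_of_succ (i := j) hG hK ((x₀, t) : X × ℝ) (((x - x₀), (0 : ℝ)) : X × ℝ)
    have heq : ((x₀, t) : X × ℝ) + ((x - x₀, (0 : ℝ)) : X × ℝ) = (x, t) := by ext <;> simp
    rw [heq] at h
    refine h.trans (le_of_eq ?_)
    simp [Prod.norm_def]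
  rw [← Real.norm_eq_abs, hx]
  exact hdiff.trans hmvt

end Rigid


/-! ## §5 Soft jets near a rigid configuration — LOCAL bound (appended) -/

section RigidLocal

variable {X : Type*} [NormedAddCommGroup X] [NormedSpace ℝ X]

/-- **Soft jets near a rigid configuration, with the `D^{j+1}` bound only on a convex set of configurations.**  `G : X × ℝ → ℝ` of class
`C^{j+1}`, `S ⊆ X` convex with `x₀, x ∈ S`, `‖D^{j+1}G(y, s)‖ ≤ K` for `y ∈ S` and all `s`, and `G(x₀, ·) ≡ 0`.  Then `|∂ₜʲ G(x, t)| ≤ K·‖x − x₀‖`.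
(Global smoothness is kept; a chart smooth only on an open tube is made global by a smooth reparametrisation of the level variable.) -/
theorem abs_iteratedDeriv_le_of_rigid_on {G : X × ℝ → ℝ} {j : ℕ} (hG : ContDiff ℝ (↑(j + 1 : ℕ)) G) {S : Set X} (hS : Convex ℝ S)
    {K : ℝ} (hK : ∀ y ∈ S, ∀ s : ℝ, ‖iteratedFDeriv ℝ (j + 1) G (y, s)‖ ≤ K) {x₀ : X} (hx₀ : x₀ ∈ S) (h0 : ∀ t, G (x₀, t) = 0)
    {x : X} (hx : x ∈ S) (t : ℝ) :
    |iteratedDeriv j (fun t : ℝ => G (x, t)) t| ≤ K * ‖x - x₀‖ := by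
  have hle : ((j : ℕ) : WithTop ℕ∞) ≤ ((j + 1 : ℕ) : WithTop ℕ∞) := by exact_mod_cast Nat.le_succ j
  have hlt : ((j : ℕ) : WithTop ℕ∞) < ((j + 1 : ℕ) : WithTop ℕ∞) := by exact_mod_cast Nat.lt_succ_self j
  have hGj : ContDiff ℝ j G := hG.of_le hle
  set L : ℝ →L[ℝ] X × ℝ := ContinuousLinearMap.inr ℝ X ℝ with hL
  have hx' := norm_iteratedDeriv_slice_eq hGj x t
  have hx0 := norm_iteratedDeriv_slice_eq hGj x₀ t
  have hzero : iteratedDeriv j (fun t : ℝ => G (x₀, t)) t = 0 := by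
    have : (fun t : ℝ => G (x₀, t)) = fun _ => (0 : ℝ) := funext h0
    rw [this, iteratedDeriv_const]
    simp
  have hnorm0 : ‖(iteratedFDeriv ℝ j G (x₀, t)).compContinuousLinearMap fun _ => L‖ = 0 := by
    rw [hL, ← hx0, hzero, norm_zero]
  have hdiff : ‖(iteratedFDeriv ℝ j G (x, t)).compContinuousLinearMap (fun _ => L)‖ ≤
      ‖iteratedFDeriv ℝ j G (x, t) - iteratedFDeriv ℝ j G (x₀, t)‖ := by
    have hsplit : (iteratedFDeriv ℝ j G (x, t)).compContinuousLinearMap (fun _ => L) =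
        (iteratedFDeriv ℝ j G (x, t) - iteratedFDeriv ℝ j G (x₀, t)).compContinuousLinearMap (fun _ => L) +
          (iteratedFDeriv ℝ j G (x₀, t)).compContinuousLinearMap (fun _ => L) := by
      rw [← ContinuousMultilinearMap.compContinuousLinearMapL_apply, ← ContinuousMultilinearMap.compContinuousLinearMapL_apply,
        ← ContinuousMultilinearMap.compContinuousLinearMapL_apply, ← map_add, sub_add_cancel]
    rw [hsplit]
    refine (norm_add_le _ _).trans ?_
    rw [hnorm0, add_zero]
    refine (ContinuousMultilinearMap.norm_compContinuousLinearMap_le _ _).trans ?_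
    have hL1 : ∏ _i : Fin j, ‖L‖ ≤ 1 := by
      rw [Finset.prod_const, Finset.card_univ, Fintype.card_fin]
      exact pow_le_one₀ (norm_nonneg _) (by rw [hL]; exact ContinuousLinearMap.norm_inr_le_one ℝ X ℝ)
    exact mul_le_of_le_one_right (norm_nonneg _) hL1
  -- the mean value inequality for DʲG on the convex set S ×ˢ univ
  have hmvt : ‖iteratedFDeriv ℝ j G (x, t) - iteratedFDeriv ℝ j G (x₀, t)‖ ≤ K * ‖x - x₀‖ := by
    set T : Set (X × ℝ) := S ×ˢ (univ : Set ℝ) with hT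
    have hTc : Convex ℝ T := hS.prod convex_univ
    have hd : ∀ p ∈ T, DifferentiableAt ℝ (iteratedFDeriv ℝ j G) p := fun p _ => (hG.differentiable_iteratedFDeriv hlt) p
    have hb : ∀ p ∈ T, ‖fderiv ℝ (iteratedFDeriv ℝ j G) p‖ ≤ K := by
      intro p hp
      rw [norm_fderiv_iteratedFDeriv]
      obtain ⟨y, s⟩ := p
      exact hK y (mem_prod.1 hp).1 s
    have h := hTc.norm_image_sub_le_of_norm_fderiv_le hd hb (mk_mem_prod hx₀ (mem_univ t)) (mk_mem_prod hx (mem_univ t))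
    refine h.trans (le_of_eq ?_)
    congr 1
    simp [Prod.norm_def]
  rw [← Real.norm_eq_abs, hx']
  exact hdiff.trans hmvt

end RigidLocal

end Summit.HubbardSuperconductivity.HubbardSuperconductivity.Theorems.C4a
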